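import Literature.Probability.LatticeModels.SixVertexGFF

/-!
# Six-vertex model: the height function of an ice configuration is a gradient height function,
# a priori bounds, measurability, and the elementary properties of the `k`-point functions
# (DKLM 2026, §2.2, Def. 2.3, Def. 2.4)

H. Duminil-Copin, K. K. Kozlowski, P. Lammers, I. Manolescu, *Gaussian free field convergence of
the six-vertex model with `-1 ≤ Δ ≤ -1/2`*, arXiv:2603.06268 (2026) [DKLM2026SixVertexGFF], §2.2,
read in the held source (`paper:arxiv-2603.06268`):

> **Definition 2.3.** Full-plane six-vertex configurations are in bijection with gradient height
> functions. More precisely, we associate any six-vertex configuration `ω` with the height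
> functions for which the height of the face on the *left* of each arrow is one unit higher than
> the height of that on its *right*.
>
> (after Def. 2.4) We immediately recognise a few basic properties of `Φ_k`, which we often use
> without further mention: `Φ_k ≡ 0` for `k` odd […]; `Φ_k` and `Φ_k^{(δ)}` are antisymmetric
> under swapping `uᵢ` and `uᵢ'`; invariant under permuting the pairs `{uᵢ, uᵢ'}`; and satisfy the
> *additivity property* `Φ_k(u₁,u₁',v) + Φ_k(u₁',u₁'',v) = Φ_k(u₁,u₁'',v)`.

`Literature/Probability/LatticeModels/SixVertexGFF.lean` defines `heightAt ω (i, j)` by summing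
the printed local rule along ONE path (east/west along row `0`, then north/south along column
`i`). This file proves the content of Definition 2.3 for that definition: **if `ω` satisfies the
ice rule at every vertex, then the height increments of `heightAt ω` across EVERY edge follow the
local rule** (`heightAt_east`, `heightAt_north`; the northward one holds by construction, the
eastward one is the discrete curl-free property of ice configurations, proved from the plaquette
identity `eastStep_succ_sub_eastStep` by induction along the column). It also provides the a
priori bound `|h(i, j)| ≤ |i| + |j|`, measurability of `ω ↦ h_ω(f)`, integrability of the
`k`-point integrand under any probability measure, and the three elementary properties of `Φ_k`
quoted above (antisymmetry, permutation invariance, additivity). The odd-`k` vanishing is in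
`SixVertexGFFProofs.lean`.

## References

* H. Duminil-Copin, K. K. Kozlowski, P. Lammers, I. Manolescu, arXiv:2603.06268 (2026), §2.2,
  Def. 2.3, Def. 2.4. [DKLM2026SixVertexGFF]
-/

noncomputable section

open MeasureTheory Filter Topology ProbabilityTheory
open scoped NNReal BoundedContinuousFunction

namespace Literature.Probability.LatticeModels.SixVertex

/-! ### The signed interval sum -/

/-- Telescoping step of the signed interval sum: `zsumIco f a (b + 1) = zsumIco f a b + f b` for
all integers `a, b` (both signs). [folklore] -/
theorem zsumIco_succ (f : ℤ → ℤ) (a b : ℤ) : zsumIco f a (b + 1) = zsumIco f a b + f b := by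
  unfold zsumIco
  by_cases hab : a ≤ b
  · rw [if_pos (by omega), if_pos hab]
    have : Finset.Ico a (b + 1) = insert b (Finset.Ico a b) := by
      ext k
      simp only [Finset.mem_Ico, Finset.mem_insert]
      omega
    rw [this, Finset.sum_insert (by simp)]
    ring
  · by_cases h1 : a ≤ b + 1
    · have ha : a = b + 1 := by omega
      subst ha
      rw [if_pos le_rfl, if_neg hab]
      have : Finset.Ico b (b + 1) = {b} := by
        ext k
        simp only [Finset.mem_Ico, Finset.mem_singleton]
        omega
      simp [this]
    · rw [if_neg h1, if_neg hab]
      have : Finset.Ico b a = insert b (Finset.Ico (b + 1) a) := by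
        ext k
        simp only [Finset.mem_Ico, Finset.mem_insert]
        omega
      rw [this, Finset.sum_insert (by simp)]
      ring

/-- `|zsumIco f a b| ≤ |b - a|` when `|f| ≤ 1` pointwise. [folklore] -/
theorem abs_zsumIco_le (f : ℤ → ℤ) (hf : ∀ k, |f k| ≤ 1) (a b : ℤ) :
    |zsumIco f a b| ≤ |b - a| := by
  have key : ∀ c d : ℤ, |∑ k ∈ Finset.Ico c d, f k| ≤ |d - c| := by
    intro c d
    refine (Finset.abs_sum_le_sum_abs _ _).trans ?_
    refine (Finset.sum_le_sum fun k _ => hf k).trans ?_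
    rw [Finset.sum_const, Int.card_Ico, nsmul_eq_mul, mul_one, abs_eq_max_neg]
    omega
  unfold zsumIco
  split_ifs with h
  · exact key a b
  · rw [abs_neg, abs_sub_comm]
    exact key b a

/-! ### Local increments -/

/-- `|eastStep| ≤ 1`. [folklore] -/
theorem abs_eastStep_le (ω : Config (ℤ × ℤ)) (x y : ℤ) : |eastStep ω x y| ≤ 1 := by
  rcases eastStep_eq_or ω x y with h | h <;> simp [h]

/-- `|northStep| ≤ 1`. [folklore] -/
theorem abs_northStep_le (ω : Config (ℤ × ℤ)) (x y : ℤ) : |northStep ω x y| ≤ 1 := by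
  rcases northStep_eq_or ω x y with h | h <;> simp [h]

/-- **Plaquette identity.** If the ice rule holds at the vertex `(x+1, t+1)`, the two ways of going
from the face `(x, t)` to the face `(x+1, t+1)` give the same height gain:
`eastStep x (t+1) - eastStep x t = northStep (x+1) t - northStep x t` (two in, two out at the
common corner). [cite: DKLM2026SixVertexGFF, Def. 2.3] -/
theorem eastStep_succ_sub_eastStep (ω : Config (ℤ × ℤ)) (x t : ℤ)
    (hv : IceRuleAt ω (x + 1, t + 1)) :
    eastStep ω x (t + 1) - eastStep ω x t = northStep ω (x + 1) t - northStep ω x t := by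
  have key : ∀ E N W S : Bool,
      (if E = true then 0 else 1) + (if W = true then 1 else 0) + (if N = true then 0 else 1) +
          (if S = true then 1 else 0) = 2 →
        (if N = true then (-1 : ℤ) else 1) - (if S = true then (-1 : ℤ) else 1) =
          (if E = true then (1 : ℤ) else -1) - (if W = true then (1 : ℤ) else -1) := by
    decide
  have hv' : (if (ω (x + 1, t + 1)).1 = true then 0 else 1) +
      (if (ω (x, t + 1)).1 = true then 1 else 0) + (if (ω (x + 1, t + 1)).2 = true then 0 else 1) +
      (if (ω (x + 1, t)).2 = true then 1 else 0) = 2 := by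
    have h := hv
    simp only [IceRuleAt, inDegree, add_sub_cancel_right] at h
    exact h
  exact key _ _ _ _ hv'

/-! ### The height function of an ice configuration is a gradient height function (Def. 2.3) -/

/-- Northward increments of `heightAt` follow the local rule (by construction, for every `ω`):
`h(x, y+1) = h(x, y) + northStep x y`. [cite: DKLM2026SixVertexGFF, Def. 2.3] -/
theorem heightAt_north (ω : Config (ℤ × ℤ)) (x y : ℤ) :
    heightAt ω (x, y + 1) = heightAt ω (x, y) + northStep ω x y := by
  unfold heightAt
  dsimp only
  rw [zsumIco_succ]
  ring

/-- Along a column, the difference of the northward sums of two adjacent columns telescopes to a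
difference of eastward increments, for an ice configuration. [cite: DKLM2026SixVertexGFF, Def. 2.3] -/
theorem zsumIco_northStep_sub (ω : Config (ℤ × ℤ)) (hice : ∀ v, IceRuleAt ω v) (x y : ℤ) :
    zsumIco (fun t => northStep ω (x + 1) t) 0 y - zsumIco (fun t => northStep ω x t) 0 y =
      eastStep ω x y - eastStep ω x 0 := by
  induction y with
  | zero => simp
  | succ i ih =>
    rw [zsumIco_succ, zsumIco_succ]
    have := eastStep_succ_sub_eastStep ω x i (hice _)
    linarith
  | pred i ih =>
    have h1 := zsumIco_succ (fun t => northStep ω (x + 1) t) 0 (-(i : ℤ) - 1)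
    have h2 := zsumIco_succ (fun t => northStep ω x t) 0 (-(i : ℤ) - 1)
    have h3 := eastStep_succ_sub_eastStep ω x (-(i : ℤ) - 1) (hice _)
    rw [show (-(i : ℤ) - 1 + 1) = -(i : ℤ) by ring] at h1 h2 h3
    linarith

/-- **Eastward increments of `heightAt` follow the local rule for ice configurations**:
`h(x+1, y) = h(x, y) + eastStep x y` at every face, although `heightAt` is defined along one
particular path — the discrete curl-free property behind "full-plane six-vertex configurations are
in bijection with gradient height functions". [cite: DKLM2026SixVertexGFF, Def. 2.3] -/
theorem heightAt_east (ω : Config (ℤ × ℤ)) (hice : ∀ v, IceRuleAt ω v) (x y : ℤ) :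
    heightAt ω (x + 1, y) = heightAt ω (x, y) + eastStep ω x y := by
  have hD := zsumIco_northStep_sub ω hice x y
  unfold heightAt
  dsimp only
  rw [zsumIco_succ]
  linarith

/-- Additivity of the signed interval sum: `zsumIco f a b + zsumIco f b c = zsumIco f a c` for all
integers. [folklore] -/
theorem zsumIco_add_zsumIco (f : ℤ → ℤ) (a b c : ℤ) :
    zsumIco f a b + zsumIco f b c = zsumIco f a c := by
  have hconst : ∀ c : ℤ, zsumIco f a c - zsumIco f b c = zsumIco f a 0 - zsumIco f b 0 := by
    intro c
    induction c with
    | zero => rfl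
    | succ i ih =>
      rw [zsumIco_succ, zsumIco_succ]
      linarith
    | pred i ih =>
      have h1 := zsumIco_succ f a (-(i : ℤ) - 1)
      have h2 := zsumIco_succ f b (-(i : ℤ) - 1)
      rw [show (-(i : ℤ) - 1 + 1) = -(i : ℤ) by ring] at h1 h2
      linarith
  have h1 := hconst c
  have h2 := hconst b
  rw [zsumIco_self] at h2
  linarith

/-- Summing the plaquette identity over a range of columns: for an ice configuration, the
northward sums along columns `a` and `b` differ by the eastward sums along rows `y` and `0`.
[cite: DKLM2026SixVertexGFF, Def. 2.3] -/
theorem zsumIco_northStep_sub_zsumIco_northStep (ω : Config (ℤ × ℤ)) (hice : ∀ v, IceRuleAt ω v)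
    (y a b : ℤ) :
    zsumIco (fun t => northStep ω b t) 0 y - zsumIco (fun t => northStep ω a t) 0 y =
      zsumIco (fun x => eastStep ω x y) a b - zsumIco (fun x => eastStep ω x 0) a b := by
  have hconst : ∀ b : ℤ, zsumIco (fun t => northStep ω b t) 0 y -
      zsumIco (fun x => eastStep ω x y) 0 b + zsumIco (fun x => eastStep ω x 0) 0 b =
      zsumIco (fun t => northStep ω 0 t) 0 y := by
    intro b
    induction b with
    | zero => simp
    | succ i ih =>
      rw [zsumIco_succ, zsumIco_succ]
      have := zsumIco_northStep_sub ω hice i y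
      linarith
    | pred i ih =>
      have h1 := zsumIco_succ (fun x => eastStep ω x y) 0 (-(i : ℤ) - 1)
      have h2 := zsumIco_succ (fun x => eastStep ω x 0) 0 (-(i : ℤ) - 1)
      have h3 := zsumIco_northStep_sub ω hice (-(i : ℤ) - 1) y
      rw [show (-(i : ℤ) - 1 + 1) = -(i : ℤ) by ring] at h1 h2 h3
      linarith
  have hb := hconst b
  have ha := hconst a
  have e1 := zsumIco_add_zsumIco (fun x => eastStep ω x y) 0 a b
  have e2 := zsumIco_add_zsumIco (fun x => eastStep ω x 0) 0 a b
  linarith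

/-- **Path independence.** For an ice configuration the height gain between any two faces `f`,
`g` is the sum of the local rule along the path "east/west along the row of `f`, then
north/south along the column of `g`" — started at ANY face `f`, not only the origin used to
define `heightAt`. [cite: DKLM2026SixVertexGFF, Def. 2.3] -/
theorem heightAt_sub_heightAt (ω : Config (ℤ × ℤ)) (hice : ∀ v, IceRuleAt ω v) (f g : ℤ × ℤ) :
    heightAt ω g - heightAt ω f =
      zsumIco (fun x => eastStep ω x f.2) f.1 g.1 +
        zsumIco (fun y => northStep ω g.1 y) f.2 g.2 := by
  have h1 := zsumIco_northStep_sub_zsumIco_northStep ω hice f.2 f.1 g.1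
  have h2 := zsumIco_add_zsumIco (fun x => eastStep ω x 0) 0 f.1 g.1
  have h3 := zsumIco_add_zsumIco (fun y => northStep ω g.1 y) 0 f.2 g.2
  unfold heightAt
  linarith

/-! ### A priori bound and measurability -/

/-- `|h(i, j)| ≤ |i| + |j|`: the height function is `1`-Lipschitz along lattice paths and vanishes
at the origin face. [folklore] -/
theorem abs_heightAt_le (ω : Config (ℤ × ℤ)) (f : ℤ × ℤ) : |heightAt ω f| ≤ |f.1| + |f.2| := by
  unfold heightAt
  refine (abs_add_le _ _).trans (add_le_add ?_ ?_)
  · simpa using abs_zsumIco_le _ (fun k => abs_eastStep_le ω k 0) 0 f.1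
  · simpa using abs_zsumIco_le _ (fun k => abs_northStep_le ω f.1 k) 0 f.2

/-- `|h(z)| ≤ |⌊re z⌋| + |⌊im z⌋|` for the piecewise-constant extension. [folklore] -/
theorem abs_heightPlane_le (ω : Config (ℤ × ℤ)) (z : ℂ) :
    |(heightPlane ω z : ℝ)| ≤ |(⌊z.re⌋ : ℝ)| + |(⌊z.im⌋ : ℝ)| := by
  have h := abs_heightAt_le ω (⌊z.re⌋, ⌊z.im⌋)
  unfold heightPlane
  exact_mod_cast h

/-- `ω ↦ eastStep ω x y` is measurable (it reads one coordinate). [folklore] -/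
theorem measurable_eastStep (x y : ℤ) : Measurable fun ω : Config (ℤ × ℤ) => eastStep ω x y :=
  (measurable_of_countable fun b : Bool × Bool => if b.2 = true then (-1 : ℤ) else 1).comp
    (measurable_pi_apply (x + 1, y))

/-- `ω ↦ northStep ω x y` is measurable (it reads one coordinate). [folklore] -/
theorem measurable_northStep (x y : ℤ) : Measurable fun ω : Config (ℤ × ℤ) => northStep ω x y :=
  (measurable_of_countable fun b : Bool × Bool => if b.1 = true then (1 : ℤ) else -1).comp
    (measurable_pi_apply (x, y + 1))

/-- Signed interval sums of measurable summands are measurable. [folklore] -/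
theorem measurable_zsumIco {f : Config (ℤ × ℤ) → ℤ → ℤ} (hf : ∀ k, Measurable fun ω => f ω k)
    (a b : ℤ) : Measurable fun ω => zsumIco (f ω) a b := by
  unfold zsumIco
  by_cases h : a ≤ b
  · simp only [if_pos h]
    exact Finset.measurable_sum _ fun k _ => hf k
  · simp only [if_neg h]
    exact (Finset.measurable_sum _ fun k _ => hf k).neg

/-- **The height at a fixed face is a measurable function of the configuration** (product
σ-algebra). [folklore] -/
theorem measurable_heightAt (f : ℤ × ℤ) : Measurable fun ω : Config (ℤ × ℤ) => heightAt ω f :=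
  (measurable_zsumIco (fun k => measurable_eastStep k 0) 0 f.1).add
    (measurable_zsumIco (fun k => measurable_northStep f.1 k) 0 f.2)

/-- `ω ↦ h_ω(z)` is measurable. [folklore] -/
theorem measurable_heightPlane (z : ℂ) : Measurable fun ω : Config (ℤ × ℤ) => heightPlane ω z :=
  measurable_heightAt _

/-- The integrand of the `k`-point function, `ω ↦ ∏ᵢ (h(uᵢ') - h(uᵢ))`, is measurable. [folklore] -/
theorem measurable_kPointIntegrand {k : ℕ} (u : Fin k → ℂ × ℂ) :
    Measurable fun ω : Config (ℤ × ℤ) =>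
      ∏ i, ((heightPlane ω (u i).2 : ℝ) - (heightPlane ω (u i).1 : ℝ)) := by
  refine Finset.measurable_prod _ fun i _ => ?_
  exact ((measurable_of_countable (Int.cast : ℤ → ℝ)).comp (measurable_heightPlane (u i).2)).sub
    ((measurable_of_countable (Int.cast : ℤ → ℝ)).comp (measurable_heightPlane (u i).1))

/-- Pointwise bound on the integrand of the `k`-point function. [folklore] -/
theorem abs_kPointIntegrand_le {k : ℕ} (u : Fin k → ℂ × ℂ) (ω : Config (ℤ × ℤ)) :
    |∏ i, ((heightPlane ω (u i).2 : ℝ) - (heightPlane ω (u i).1 : ℝ))| ≤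
      ∏ i, (|(⌊(u i).2.re⌋ : ℝ)| + |(⌊(u i).2.im⌋ : ℝ)| + (|(⌊(u i).1.re⌋ : ℝ)| + |(⌊(u i).1.im⌋ : ℝ)|)) := by
  rw [Finset.abs_prod]
  refine Finset.prod_le_prod (fun i _ => abs_nonneg _) fun i _ => ?_
  exact (abs_sub _ _).trans (add_le_add (abs_heightPlane_le ω _) (abs_heightPlane_le ω _))

/-- **The `k`-point integrand is integrable under every probability measure** on configurations
(it is bounded and measurable), so `Φ_k` is a genuine expectation. [cite: DKLM2026SixVertexGFF, Def. 2.4] -/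
theorem integrable_kPointIntegrand (P : Measure (Config (ℤ × ℤ))) [IsProbabilityMeasure P] {k : ℕ}
    (u : Fin k → ℂ × ℂ) :
    Integrable (fun ω : Config (ℤ × ℤ) =>
      ∏ i, ((heightPlane ω (u i).2 : ℝ) - (heightPlane ω (u i).1 : ℝ))) P :=
  Integrable.of_bound (measurable_kPointIntegrand u).aestronglyMeasurable _
    (Eventually.of_forall fun ω => (Real.norm_eq_abs _).le.trans (abs_kPointIntegrand_le u ω))

/-! ### Elementary properties of the `k`-point functions (remarks after Def. 2.4) -/

/-- **Antisymmetry**: swapping `uᵢ` and `uᵢ'` changes the sign of `Φ_k`.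
[cite: DKLM2026SixVertexGFF, Def. 2.4] -/
theorem kPoint_update_swap (P : Measure (Config (ℤ × ℤ))) {k : ℕ} (u : Fin k → ℂ × ℂ) (i : Fin k) :
    kPoint P k (Function.update u i ((u i).2, (u i).1)) = -kPoint P k u := by
  unfold kPoint
  rw [← integral_neg]
  refine integral_congr_ae (Eventually.of_forall fun ω => ?_)
  have h := Finset.prod_update_of_mem (Finset.mem_univ i)
    (fun j => ((heightPlane ω (u j).2 : ℝ) - (heightPlane ω (u j).1 : ℝ)))
    ((heightPlane ω (u i).1 : ℝ) - (heightPlane ω (u i).2 : ℝ))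
  have h' := Finset.prod_update_of_mem (Finset.mem_univ i)
    (fun j => ((heightPlane ω (u j).2 : ℝ) - (heightPlane ω (u j).1 : ℝ)))
    ((heightPlane ω (u i).2 : ℝ) - (heightPlane ω (u i).1 : ℝ))
  rw [Function.update_eq_self] at h'
  have hfun : (fun j => ((heightPlane ω (Function.update u i ((u i).2, (u i).1) j).2 : ℝ) -
      (heightPlane ω (Function.update u i ((u i).2, (u i).1) j).1 : ℝ))) =
      Function.update (fun j => ((heightPlane ω (u j).2 : ℝ) - (heightPlane ω (u j).1 : ℝ))) i
        ((heightPlane ω (u i).1 : ℝ) - (heightPlane ω (u i).2 : ℝ)) := by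
    funext j
    by_cases hj : j = i
    · subst hj
      simp
    · simp [Function.update_of_ne hj]
  simp only [hfun, h, h']
  ring

/-- **Permutation invariance**: `Φ_k` is invariant under permuting the pairs `{uᵢ, uᵢ'}`.
[cite: DKLM2026SixVertexGFF, Def. 2.4] -/
theorem kPoint_comp_perm (P : Measure (Config (ℤ × ℤ))) {k : ℕ} (u : Fin k → ℂ × ℂ)
    (σ : Equiv.Perm (Fin k)) : kPoint P k (u ∘ σ) = kPoint P k u := by
  unfold kPoint
  refine integral_congr_ae (Eventually.of_forall fun ω => ?_)
  exact Equiv.prod_comp σ (fun j => ((heightPlane ω (u j).2 : ℝ) - (heightPlane ω (u j).1 : ℝ)))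

/-- **Additivity**: `Φ_{k+1}(u₁,u₁',v) + Φ_{k+1}(u₁',u₁'',v) = Φ_{k+1}(u₁,u₁'',v)` for every
probability measure (integrability of the bounded integrands). [cite: DKLM2026SixVertexGFF, Def. 2.4] -/
theorem kPoint_cons_add_kPoint_cons (P : Measure (Config (ℤ × ℤ))) [IsProbabilityMeasure P] {k : ℕ}
    (u₁ u₁' u₁'' : ℂ) (v : Fin k → ℂ × ℂ) :
    kPoint P (k + 1) (Fin.cons (u₁, u₁') v) + kPoint P (k + 1) (Fin.cons (u₁', u₁'') v) =
      kPoint P (k + 1) (Fin.cons (u₁, u₁'') v) := by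
  unfold kPoint
  rw [← integral_add (integrable_kPointIntegrand P _) (integrable_kPointIntegrand P _)]
  refine integral_congr_ae (Eventually.of_forall fun ω => ?_)
  simp only [Fin.prod_univ_succ, Fin.cons_zero, Fin.cons_succ]
  ring

end Literature.Probability.LatticeModels.SixVertex

end
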